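import Mathlib
import HarnessLib
import Summits.NavierStokesRegularity.NavierStokesRegularity.Theorems.UnthreadedDoorAntidynamoWallCoreReductionInstant
import Summits.NavierStokesRegularity.NavierStokesRegularity.Theorems.UnthreadedDoorAntidynamoWallOneInstantLocalSymmetry

/-!
# Route `UnthreadedDoor` / `ThreadingFlux`, crux `PoloidalLiouville` (stmt-NavierStokesRegularity-1222), antidynamo v2 skeleton (sha16 `4ebf5683127b`),
# WALL `stub_scalarLiouville`: THE WALL REDUCES TO ITS CORE, BY NAME — v3, with the one-instant LOCAL SYMMETRY conditions

Support file (seat leafhand-ns-unthreadeddoor-2 g2, cell decomp-ns), `--supports stmt-NavierStokesRegularity-1222 --as helper`; theorems only.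

`stubScalarLiouville_of_core''` sharpens v2 (`stubScalarLiouville_of_core'`, p818689): to prove the registered wall `Antidynamo.StubScalarLiouville` (hence the
crux `PoloidalLiouville`, `poloidalLiouville_of_core''`) it SUFFICES to prove its conclusion for flows of the wall's class that IN ADDITION
(C1) are jointly REAL-ANALYTIC in their given frame on `(−∞,0) × ℝ³`;
(C2) have `{x | curl v(t,x) ≠ 0}` DENSE in `ℝ³` at every `t < 0`;
(C3') at NO instant admit a non-zero vector orthogonal to the vorticity on a non-empty open set;
(C6) **at NO instant, about NO axis (any point `x₁`, any frame `R`), on NO non-empty open set is the straightened vorticity `curl (conjAxis R x₁ (v t))`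
     axisymmetric** (swirl allowed) — `OneInstant.curl_eq_zero_of_curl_axisymmetric_on_open`;
(C7) **every LOCAL RIGID SYMMETRY of the vorticity — at one instant, about one centre `x₁`, under one linear isometry `R`, on one non-empty open set — is an
     EXACT `R`-equivariance of the VELOCITY about `x₀` at ALL times** — `OneInstant.curl_eq_zero_or_equivariant_of_curl_symmetric_on_open`;
(C4) are NOT anti-symmetric as a pseudovector about `x₀` under any linear isometry on any far past `(−∞, t₁)`;
(C5) are NOT generalized-Beltrami in any smooth Galilean frame on any far past.

HONEST LABEL: a by-name reduction (pure logic over landed closers); the core statement is OPEN (it is the wall on its residual); nothing here proves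
`stub_scalarLiouville`, `PoloidalLiouville` (1222), or bears on Navier–Stokes regularity; no summit statement is proved (crux 1222 is INCOMPARABLE with
the summit). [folklore] [cite: KochNadirashviliSereginSverak2009, Thm 5.2 (arXiv:0709.3599 pp. 9–10)]
-/

noncomputable section

-- the summit and its single sub-problem share the name (CONVENTIONS §1)
set_option linter.dupNamespace false

open scoped Topology InnerProductSpace RealInnerProductSpace ContDiff
open Filter Set Function Metric MeasureTheory
open Literature.Analysis.FluidPDE

namespace Summit.NavierStokesRegularity.NavierStokesRegularity.Theorems.PoloidalLiouville.Antidynamo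

open Summit.NavierStokesRegularity.NavierStokesRegularity.Theorems.PoloidalLiouville.CellFlux (conjAxis)

/-- **THE CORE OF THE WALL, v3** (a hypothesis shape, no new definition): the wall's conclusion for the flows of its class satisfying (C1), (C2), (C3'),
(C6), (C7), (C4), (C5) of the module docstring. -/
theorem stubScalarLiouville_of_core''
    (hcore : ∀ (v : ℝ → EuclideanSpace ℝ (Fin 3) → EuclideanSpace ℝ (Fin 3)) (x₀ : EuclideanSpace ℝ (Fin 3))
      (T : ℝ → EuclideanSpace ℝ (Fin 3) → ℝ),
      Literature.Analysis.FluidPDE.IsBoundedAncientMildSolution 1 v →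
      (∀ t < 0, AEStronglyMeasurable (v t) volume) →
      ContDiffOn ℝ (⊤ : ℕ∞) (Function.uncurry v) (Set.Iio 0 ×ˢ Set.univ) →
      ContDiffOn ℝ (⊤ : ℕ∞) (Function.uncurry T) (Set.Iio 0 ×ˢ ({x₀}ᶜ : Set (EuclideanSpace ℝ (Fin 3)))) →
      (∃ C : ℝ, ∀ t < 0, ∀ x, |T t x| ≤ C) →
      (∀ t < 0, ∀ x, Literature.Analysis.FluidPDE.curl (v t) x =
        Literature.Analysis.FluidPDE.cross (gradient (T t) x) (x - x₀)) →
      (∀ t < 0, ∀ x, x ≠ x₀ →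
        Literature.Analysis.FluidPDE.cross
            (gradient (fun z => deriv (fun s => T s z) t + inner ℝ (v t z) (gradient (T t) z)
              - Laplacian.laplacian (T t) z) x) (x - x₀) =
          Literature.Analysis.FluidPDE.cross (gradient (fun z => inner ℝ (v t z) (z - x₀)) x) (gradient (T t) x)) →
      -- (C1) analytic in the given frame
      AnalyticOnNhd ℝ (Function.uncurry v) (Iio (0 : ℝ) ×ˢ (univ : Set (EuclideanSpace ℝ (Fin 3)))) →
      -- (C2) dense non-vanishing of the vorticity at every time
      (∀ t < 0, Dense {x : EuclideanSpace ℝ (Fin 3) | curl (v t) x ≠ 0}) →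
      -- (C3') no local flat direction at any instant
      (∀ t < 0, ¬ ∃ e : EuclideanSpace ℝ (Fin 3), e ≠ 0 ∧
        ∃ U : Set (EuclideanSpace ℝ (Fin 3)), IsOpen U ∧ U.Nonempty ∧ ∀ x ∈ U, ⟪e, curl (v t) x⟫ = 0) →
      -- (C6) no local axisymmetry of the straightened vorticity at any instant, about any axis
      (∀ t < 0, ∀ (R : EuclideanSpace ℝ (Fin 3) ≃ₗᵢ[ℝ] EuclideanSpace ℝ (Fin 3)) (x₁ : EuclideanSpace ℝ (Fin 3))
        (U : Set (EuclideanSpace ℝ (Fin 3))), IsOpen U → U.Nonempty →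
        ¬ ∀ θ : ℝ, ∀ y ∈ U, curl (conjAxis R x₁ (v t)) (rotZ θ y) = rotZ θ (curl (conjAxis R x₁ (v t)) y)) →
      -- (C7) every local rigid symmetry of the vorticity at any instant is an exact equivariance of the velocity about `x₀` at all times
      (∀ t < 0, ∀ (R : EuclideanSpace ℝ (Fin 3) ≃ₗᵢ[ℝ] EuclideanSpace ℝ (Fin 3)) (x₁ : EuclideanSpace ℝ (Fin 3))
        (U : Set (EuclideanSpace ℝ (Fin 3))), IsOpen U → U.Nonempty →
        (∀ y ∈ U, curl (v t) (x₁ + R y) =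
          (R : EuclideanSpace ℝ (Fin 3) →L[ℝ] EuclideanSpace ℝ (Fin 3)).det • R (curl (v t) (x₁ + y))) →
        ∀ s < 0, ∀ y, v s (x₀ + R y) = R (v s (x₀ + y))) →
      -- (C4) not anti-symmetric under any linear isometry on any far past
      (∀ (R : EuclideanSpace ℝ (Fin 3) ≃ₗᵢ[ℝ] EuclideanSpace ℝ (Fin 3)) (t₁ : ℝ), t₁ ≤ 0 →
        ¬ ∀ t < t₁, ∀ y, curl (v t) (x₀ + R y) =
          -((R : EuclideanSpace ℝ (Fin 3) →L[ℝ] EuclideanSpace ℝ (Fin 3)).det • R (curl (v t) (x₀ + y)))) →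
      -- (C5) not generalized-Beltrami in any smooth Galilean frame on any far past
      (∀ (t₁ : ℝ), t₁ ≤ 0 → ∀ b : ℝ → EuclideanSpace ℝ (Fin 3), ContDiffOn ℝ ∞ b (Iio t₁) →
        ¬ ∀ t < t₁, ∀ x, curl (fun y => cross (v t y - b t) (curl (v t) y)) x = 0) →
      ∀ t < 0, ∀ x, Literature.Analysis.FluidPDE.cross (gradient (T t) x) (x - x₀) = 0) :
    StubScalarLiouville := by
  refine stubScalarLiouville_of_core' fun v x₀ T hB hm hsm hT hTb hrep hE hC1 hC2 hC3 hC4 hC5 => ?_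
  -- a toroidal field is tangent to the spheres about its centre
  have hun : ∀ t < 0, ∀ x, ⟪x - x₀, curl (v t) x⟫ = 0 := fun t ht x => by
    rw [hrep t ht x]
    simp [cross, crossProduct, PiLp.inner_apply, Fin.sum_univ_three]
    ring
  by_cases h0 : ∀ t < 0, ∀ x, curl (v t) x = 0
  · intro t ht x
    rw [← hrep t ht x]
    exact h0 t ht x
  -- otherwise (C6) and (C7) hold by the local one-instant symmetry theorems
  have hC6 : ∀ t < 0, ∀ (R : EuclideanSpace ℝ (Fin 3) ≃ₗᵢ[ℝ] EuclideanSpace ℝ (Fin 3)) (x₁ : EuclideanSpace ℝ (Fin 3))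
      (U : Set (EuclideanSpace ℝ (Fin 3))), IsOpen U → U.Nonempty →
      ¬ ∀ θ : ℝ, ∀ y ∈ U, curl (conjAxis R x₁ (v t)) (rotZ θ y) = rotZ θ (curl (conjAxis R x₁ (v t)) y) :=
    fun t ht R x₁ U hUo hUne hax =>
      h0 (OneInstant.curl_eq_zero_of_curl_axisymmetric_on_open v x₀ hB hm hsm hun R x₁ ht hUo hUne hax)
  have hC7 : ∀ t < 0, ∀ (R : EuclideanSpace ℝ (Fin 3) ≃ₗᵢ[ℝ] EuclideanSpace ℝ (Fin 3)) (x₁ : EuclideanSpace ℝ (Fin 3))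
      (U : Set (EuclideanSpace ℝ (Fin 3))), IsOpen U → U.Nonempty →
      (∀ y ∈ U, curl (v t) (x₁ + R y) =
        (R : EuclideanSpace ℝ (Fin 3) →L[ℝ] EuclideanSpace ℝ (Fin 3)).det • R (curl (v t) (x₁ + y))) →
      ∀ s < 0, ∀ y, v s (x₀ + R y) = R (v s (x₀ + y)) :=
    fun t ht R x₁ U hUo hUne hU =>
      (OneInstant.curl_eq_zero_or_equivariant_of_curl_symmetric_on_open v x₀ hB hm hsm hun R x₁ ht hUo hUne hU).resolve_left h0
  exact hcore v x₀ T hB hm hsm hT hTb hrep hE hC1 hC2 hC3 hC6 hC7 hC4 hC5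

/-- **… AND THE CRUX**: the same v3 core statement gives `PoloidalLiouville` (route `UnthreadedDoor` decl; composition p793469 by name). -/
theorem poloidalLiouville_of_core''
    (hcore : ∀ (v : ℝ → EuclideanSpace ℝ (Fin 3) → EuclideanSpace ℝ (Fin 3)) (x₀ : EuclideanSpace ℝ (Fin 3))
      (T : ℝ → EuclideanSpace ℝ (Fin 3) → ℝ),
      Literature.Analysis.FluidPDE.IsBoundedAncientMildSolution 1 v →
      (∀ t < 0, AEStronglyMeasurable (v t) volume) →
      ContDiffOn ℝ (⊤ : ℕ∞) (Function.uncurry v) (Set.Iio 0 ×ˢ Set.univ) →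
      ContDiffOn ℝ (⊤ : ℕ∞) (Function.uncurry T) (Set.Iio 0 ×ˢ ({x₀}ᶜ : Set (EuclideanSpace ℝ (Fin 3)))) →
      (∃ C : ℝ, ∀ t < 0, ∀ x, |T t x| ≤ C) →
      (∀ t < 0, ∀ x, Literature.Analysis.FluidPDE.curl (v t) x =
        Literature.Analysis.FluidPDE.cross (gradient (T t) x) (x - x₀)) →
      (∀ t < 0, ∀ x, x ≠ x₀ →
        Literature.Analysis.FluidPDE.cross
            (gradient (fun z => deriv (fun s => T s z) t + inner ℝ (v t z) (gradient (T t) z)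
              - Laplacian.laplacian (T t) z) x) (x - x₀) =
          Literature.Analysis.FluidPDE.cross (gradient (fun z => inner ℝ (v t z) (z - x₀)) x) (gradient (T t) x)) →
      AnalyticOnNhd ℝ (Function.uncurry v) (Iio (0 : ℝ) ×ˢ (univ : Set (EuclideanSpace ℝ (Fin 3)))) →
      (∀ t < 0, Dense {x : EuclideanSpace ℝ (Fin 3) | curl (v t) x ≠ 0}) →
      (∀ t < 0, ¬ ∃ e : EuclideanSpace ℝ (Fin 3), e ≠ 0 ∧
        ∃ U : Set (EuclideanSpace ℝ (Fin 3)), IsOpen U ∧ U.Nonempty ∧ ∀ x ∈ U, ⟪e, curl (v t) x⟫ = 0) →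
      (∀ t < 0, ∀ (R : EuclideanSpace ℝ (Fin 3) ≃ₗᵢ[ℝ] EuclideanSpace ℝ (Fin 3)) (x₁ : EuclideanSpace ℝ (Fin 3))
        (U : Set (EuclideanSpace ℝ (Fin 3))), IsOpen U → U.Nonempty →
        ¬ ∀ θ : ℝ, ∀ y ∈ U, curl (conjAxis R x₁ (v t)) (rotZ θ y) = rotZ θ (curl (conjAxis R x₁ (v t)) y)) →
      (∀ t < 0, ∀ (R : EuclideanSpace ℝ (Fin 3) ≃ₗᵢ[ℝ] EuclideanSpace ℝ (Fin 3)) (x₁ : EuclideanSpace ℝ (Fin 3))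
        (U : Set (EuclideanSpace ℝ (Fin 3))), IsOpen U → U.Nonempty →
        (∀ y ∈ U, curl (v t) (x₁ + R y) =
          (R : EuclideanSpace ℝ (Fin 3) →L[ℝ] EuclideanSpace ℝ (Fin 3)).det • R (curl (v t) (x₁ + y))) →
        ∀ s < 0, ∀ y, v s (x₀ + R y) = R (v s (x₀ + y))) →
      (∀ (R : EuclideanSpace ℝ (Fin 3) ≃ₗᵢ[ℝ] EuclideanSpace ℝ (Fin 3)) (t₁ : ℝ), t₁ ≤ 0 →
        ¬ ∀ t < t₁, ∀ y, curl (v t) (x₀ + R y) =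
          -((R : EuclideanSpace ℝ (Fin 3) →L[ℝ] EuclideanSpace ℝ (Fin 3)).det • R (curl (v t) (x₀ + y)))) →
      (∀ (t₁ : ℝ), t₁ ≤ 0 → ∀ b : ℝ → EuclideanSpace ℝ (Fin 3), ContDiffOn ℝ ∞ b (Iio t₁) →
        ¬ ∀ t < t₁, ∀ x, curl (fun y => cross (v t y - b t) (curl (v t) y)) x = 0) →
      ∀ t < 0, ∀ x, Literature.Analysis.FluidPDE.cross (gradient (T t) x) (x - x₀) = 0) :
    Summit.NavierStokesRegularity.NavierStokesRegularity.Theses.UnthreadedDoor.PoloidalLiouville :=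
  poloidalLiouville_of_stubScalarLiouville' (stubScalarLiouville_of_core'' hcore)

end Summit.NavierStokesRegularity.NavierStokesRegularity.Theorems.PoloidalLiouville.Antidynamo

end
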